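import Literature.Algebra.Polynomial.DescartesSignVariations
import Summits.ValiantsHypothesis.ValiantsHypothesis.Theorems.KPlusLogSqLawTridiagonalRealStaticPotentialRow

/-!
# Route «KPlusLogSqLaw», crux `WeakLifting` (stmt-ValiantsHypothesis-19561) — REAL side of the tridiagonal sector:
# the CELL LEMMAS of the potential line — where the zeros of the next continuant can lie

HONEST FRAMING.  Helper (`--supports stmt-ValiantsHypothesis-19561 --as helper`), seat val-sym-lift-p3 (g10), cell `pub-symmetroid`,
2026-08-28; the structural layer under conjecture (P) (memo CONDITIONAL-UPPER-ROW-liftp3g10.md §6, g9 memo §8(1b)): for a static DEFINITE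
symmetric tridiagonal design with NONZERO links (`D_{k+2} = A·D_{k+1} − B·D_k` with `A = a_{k+1}x^{d_{k+1}} > 0`, `B = b_k²x^{2f_k} > 0` on `x > 0`),
* `eval_succ_mul_eval_pos_of_root` — **SAME-SIGN LEMMA**: at every positive zero of `D_{k+2}` the two previous continuants are nonzero and of the
  SAME sign (`D_{k+1}(x)·D_k(x) > 0`): the zeros of `D_{k+2}` lie in the «positive cells» of `Z(D_k) ∪ Z(D_{k+1})`;
* `eval_ne_zero_of_eval_add_two_eq_zero` — `D_{k+2}` and `D_k` share no positive zero (as `D_{k+2}` and `D_{k+1}` do not, `…PotentialRow`);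
* `no_root_of_opposite_signs` — on a set where `D_k` and `D_{k+1}` have opposite (weak) signs, `D_{k+2}` has no zero («negative cells are empty»);
* `eval_add_two_of_root_succ` / `sign at the zeros of D_{k+1}` — at a positive zero `z` of `D_{k+1}`, `D_{k+2}(z) = −B(z)·D_k(z)` has the sign
  OPPOSITE to `D_k(z)` (the parity rule behind «even number of zeros of `D_{k+2}` between consecutive zeros of `D_{k+1}` not separated by `D_k`»;
  the interval count itself is left to the file that needs it).
Elementary consequences of the three-term recurrence; nothing here bounds anything globally; (P) stays OPEN; α does not move.  Nothing here bears on
`WeakLifting` / `TropicalB` (stmt-19771) in their windows, on Conjecture B, on the Door-A registers, on `MatrixDescartes` (stmt-ValiantsHypothesis-18050)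
or on VP ≠ VNP.
[folklore: continuants / Sturm-type sign bookkeeping; this cell's memos]
-/

-- `Summit.ValiantsHypothesis.ValiantsHypothesis.…` repeats a component by the D-0017 layout (single-conjunct summit); the name is mandated.
set_option linter.dupNamespace false
set_option autoImplicit false

namespace Summit.ValiantsHypothesis.ValiantsHypothesis.Theorems.KPlusLogSqLaw

namespace StaticTridiagonalRealPotential

open Polynomial

variable (a : ℕ → ℝ) (d : ℕ → ℕ) (b : ℕ → ℝ) (f : ℕ → ℕ)

/-- The recurrence, evaluated: `D_{k+2}(x) = a_{k+1}x^{d_{k+1}}·D_{k+1}(x) − (b_k x^{f_k})²·D_k(x)`. [folklore] -/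
theorem eval_pathDet_add_two (k : ℕ) (x : ℝ) :
    (pathDet a d b f (k + 2)).eval x =
      a (k + 1) * x ^ d (k + 1) * (pathDet a d b f (k + 1)).eval x - (b k * x ^ f k) ^ 2 * (pathDet a d b f k).eval x := by
  rw [pathDet_add_two]; simp only [eval_sub, eval_mul, eval_pow, eval_C, eval_X]

/-- **At a zero of `D_{k+1}`, `D_{k+2} = −(b_k x^{f_k})² · D_k`.** [folklore] -/
theorem eval_add_two_of_root_succ (k : ℕ) {x : ℝ} (h : (pathDet a d b f (k + 1)).eval x = 0) :
    (pathDet a d b f (k + 2)).eval x = -((b k * x ^ f k) ^ 2 * (pathDet a d b f k).eval x) := by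
  rw [eval_pathDet_add_two, h, mul_zero, zero_sub]

/-- **`D_{k+2}` and `D_k` share no positive zero** (nonzero links): a common zero would be a zero of `D_{k+1}` too. [folklore] -/
theorem eval_ne_zero_of_eval_add_two_eq_zero (ha : ∀ t, 0 < a t) (hb : ∀ t, b t ≠ 0) (k : ℕ) {x : ℝ} (hx : 0 < x)
    (h : (pathDet a d b f (k + 2)).eval x = 0) : (pathDet a d b f k).eval x ≠ 0 := by
  intro hk
  -- then `A · D_{k+1}(x) = 0`, so `D_{k+1}(x) = 0`: a common zero of `D_k`, `D_{k+1}`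
  have h1 : (pathDet a d b f (k + 1)).eval x = 0 := by
    have h' := h
    rw [eval_pathDet_add_two, hk, mul_zero, sub_zero] at h'
    rcases mul_eq_zero.1 h' with h'' | h''
    · exact absurd h'' (mul_ne_zero (ha _).ne' (pow_ne_zero _ hx.ne'))
    · exact h''
  exact eval_pathDet_succ_ne_zero a d b f hb hx k hk h1

/-- **SAME-SIGN LEMMA**: at a positive zero of `D_{k+2}` the two previous continuants are nonzero and of the same sign,
`D_{k+1}(x) · D_k(x) > 0` — the zeros of `D_{k+2}` lie in the POSITIVE cells of `Z(D_k) ∪ Z(D_{k+1})`. [folklore; this cell's memos] -/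
theorem eval_succ_mul_eval_pos_of_root (ha : ∀ t, 0 < a t) (hb : ∀ t, b t ≠ 0) (k : ℕ) {x : ℝ} (hx : 0 < x)
    (h : (pathDet a d b f (k + 2)).eval x = 0) :
    0 < (pathDet a d b f (k + 1)).eval x * (pathDet a d b f k).eval x := by
  have hk : (pathDet a d b f k).eval x ≠ 0 := eval_ne_zero_of_eval_add_two_eq_zero a d b f ha hb k hx h
  have hA : 0 < a (k + 1) * x ^ d (k + 1) := mul_pos (ha _) (pow_pos hx _)
  have hB : 0 < (b k * x ^ f k) ^ 2 := lt_of_le_of_ne (sq_nonneg _) (Ne.symm (pow_ne_zero 2 (mul_ne_zero (hb k) (pow_ne_zero _ hx.ne'))))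
  -- `A · D_{k+1}(x) = B · D_k(x)`, hence `A · (D_{k+1} D_k)(x) = B · D_k(x)² > 0`
  have heq : a (k + 1) * x ^ d (k + 1) * (pathDet a d b f (k + 1)).eval x = (b k * x ^ f k) ^ 2 * (pathDet a d b f k).eval x := by
    rw [eval_pathDet_add_two] at h; linarith
  have hsq : 0 < (pathDet a d b f k).eval x ^ 2 := lt_of_le_of_ne (sq_nonneg _) (Ne.symm (pow_ne_zero 2 hk))
  have : 0 < a (k + 1) * x ^ d (k + 1) * ((pathDet a d b f (k + 1)).eval x * (pathDet a d b f k).eval x) := by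
    have e : a (k + 1) * x ^ d (k + 1) * ((pathDet a d b f (k + 1)).eval x * (pathDet a d b f k).eval x) =
        (b k * x ^ f k) ^ 2 * (pathDet a d b f k).eval x ^ 2 := by
      rw [← mul_assoc, heq]; ring
    rw [e]; exact mul_pos hB hsq
  exact (mul_pos_iff_of_pos_left hA).1 this

/-- **NEGATIVE CELLS ARE EMPTY**: where `D_{k+1}` and `D_k` have opposite weak signs (`D_{k+1}(x)·D_k(x) ≤ 0`), `D_{k+2}` does not vanish
(`x > 0`, nonzero links). [corollary] -/
theorem no_root_of_opposite_signs (ha : ∀ t, 0 < a t) (hb : ∀ t, b t ≠ 0) (k : ℕ) {x : ℝ} (hx : 0 < x)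
    (hopp : (pathDet a d b f (k + 1)).eval x * (pathDet a d b f k).eval x ≤ 0) : (pathDet a d b f (k + 2)).eval x ≠ 0 :=
  fun h => absurd (eval_succ_mul_eval_pos_of_root a d b f ha hb k hx h) (not_lt.2 hopp)

/-- **Sign at the zeros of the previous continuant**: at a positive zero `z` of `D_{k+1}`, `D_{k+2}(z)` and `D_k(z)` are nonzero and of
OPPOSITE signs (`D_{k+2}(z)·D_k(z) < 0`).  Between two consecutive zeros of `D_{k+1}` carrying the same sign of `D_k`, `D_{k+2}` therefore
takes the same sign at both ends (an even number of zeros in between, counted with multiplicity — the parity half of the cell picture).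
[folklore; this cell's memos] -/
theorem eval_add_two_mul_eval_neg_of_root_succ (hb : ∀ t, b t ≠ 0) (k : ℕ) {x : ℝ} (hx : 0 < x)
    (h : (pathDet a d b f (k + 1)).eval x = 0) : (pathDet a d b f (k + 2)).eval x * (pathDet a d b f k).eval x < 0 := by
  have hk : (pathDet a d b f k).eval x ≠ 0 := fun hk => eval_pathDet_succ_ne_zero a d b f hb hx k hk h
  have hB : 0 < (b k * x ^ f k) ^ 2 := lt_of_le_of_ne (sq_nonneg _) (Ne.symm (pow_ne_zero 2 (mul_ne_zero (hb k) (pow_ne_zero _ hx.ne'))))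
  have hsq : 0 < (pathDet a d b f k).eval x ^ 2 := lt_of_le_of_ne (sq_nonneg _) (Ne.symm (pow_ne_zero 2 hk))
  rw [eval_add_two_of_root_succ a d b f k h]
  have e : -((b k * x ^ f k) ^ 2 * (pathDet a d b f k).eval x) * (pathDet a d b f k).eval x =
      -((b k * x ^ f k) ^ 2 * (pathDet a d b f k).eval x ^ 2) := by ring
  rw [e, neg_lt_zero]
  exact mul_pos hB hsq

/-- **Consecutive same-cell zeros**: if `u < v` are positive zeros of `D_{k+1}` at which `D_k` has the same sign (no zero of `D_k` of odd order
separates them, e.g. `D_k > 0` on both), then `D_{k+2}(u)` and `D_{k+2}(v)` have the same sign: `D_{k+2}(u)·D_{k+2}(v) > 0`. [corollary] -/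
theorem eval_add_two_mul_pos_of_roots_succ (hb : ∀ t, b t ≠ 0) (k : ℕ) {u v : ℝ} (hu : 0 < u) (hv : 0 < v)
    (hru : (pathDet a d b f (k + 1)).eval u = 0) (hrv : (pathDet a d b f (k + 1)).eval v = 0)
    (hsame : 0 < (pathDet a d b f k).eval u * (pathDet a d b f k).eval v) :
    0 < (pathDet a d b f (k + 2)).eval u * (pathDet a d b f (k + 2)).eval v := by
  have h1 := eval_add_two_mul_eval_neg_of_root_succ a d b f hb k hu hru
  have h2 := eval_add_two_mul_eval_neg_of_root_succ a d b f hb k hv hrv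
  -- product of two negative quantities, divided by the positive `D_k(u) D_k(v)`
  have h12 := mul_pos_of_neg_of_neg h1 h2
  have e : (pathDet a d b f (k + 2)).eval u * (pathDet a d b f k).eval u * ((pathDet a d b f (k + 2)).eval v * (pathDet a d b f k).eval v) =
      ((pathDet a d b f (k + 2)).eval u * (pathDet a d b f (k + 2)).eval v) * ((pathDet a d b f k).eval u * (pathDet a d b f k).eval v) := by
    ring
  rw [e] at h12
  exact (mul_pos_iff_of_pos_right hsame).1 h12

end StaticTridiagonalRealPotential

end Summit.ValiantsHypothesis.ValiantsHypothesis.Theorems.KPlusLogSqLaw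

/-! ## Appended (same seat, same session): the PARITY RULE in a positive cell, with multiplicity

From the tree's Descartes anchor (`Literature.Algebra.Polynomial.Descartes.even_countP_roots_gt_iff`: the number of roots `> x`, with
multiplicity, is even iff `P(x)` has the sign of the leading coefficient): if `P(u)·P(v) > 0` then `P` has an EVEN number of roots in `(u, v]`
counted with multiplicity; hence between two positive zeros of `D_{k+1}` at which `D_k` has the same sign, `D_{k+2}` has an even number of zeros
(with multiplicity).  [cite: BasuPollackRoy2006, Prop. 2.21 / Thm. 2.33 via the tree's anchor; folklore]
-/

namespace Summit.ValiantsHypothesis.ValiantsHypothesis.Theorems.KPlusLogSqLaw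

namespace StaticTridiagonalRealPotential

open Polynomial
open Literature.Algebra.Polynomial.Descartes (even_countP_roots_gt_iff)

variable (a : ℕ → ℝ) (d : ℕ → ℕ) (b : ℕ → ℝ) (f : ℕ → ℕ)

/-- **Parity on an interval**: if `P(u)` and `P(v)` are nonzero of the same sign (`u ≤ v`), the number of roots of `P` in `(u, v]`, counted with
multiplicity, is EVEN. [cite: BasuPollackRoy2006, Prop. 2.21; via the tree's `even_countP_roots_gt_iff`] -/
theorem even_countP_roots_Ioc_of_mul_pos {P : ℝ[X]} {u v : ℝ} (huv : u ≤ v) (h : 0 < P.eval u * P.eval v) :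
    Even (P.roots.countP (fun x => u < x ∧ x ≤ v)) := by
  classical
  have hu : P.eval u ≠ 0 := fun h0 => by rw [h0, zero_mul] at h; exact lt_irrefl _ h
  have hv : P.eval v ≠ 0 := fun h0 => by rw [h0, mul_zero] at h; exact lt_irrefl _ h
  -- `#(u, ∞) = #(u, v] + #(v, ∞)`
  have hsplit : P.roots.countP (fun x => u < x) = P.roots.countP (fun x => u < x ∧ x ≤ v) + P.roots.countP (fun x => v < x) := by
    rw [Multiset.countP_eq_countP_filter_add _ (fun x => u < x) (fun x => x ≤ v), Multiset.countP_filter, Multiset.countP_filter]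
    congr 1
    refine Multiset.countP_congr rfl fun x _ => ?_
    simp only [not_le, eq_iff_iff]
    exact ⟨fun ⟨_, h2⟩ => h2, fun h2 => ⟨lt_of_le_of_lt huv h2, h2⟩⟩
  -- both tails have the parity dictated by the (common) sign of `P(u)`, `P(v)` against the leading coefficient
  have hpu := even_countP_roots_gt_iff hu
  have hpv := even_countP_roots_gt_iff hv
  have hiff : (0 < P.leadingCoeff * P.eval u) ↔ (0 < P.leadingCoeff * P.eval v) := by
    have hlc : P.leadingCoeff ≠ 0 := fun h0 => hu (by rw [leadingCoeff_eq_zero.1 h0, eval_zero])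
    have hprod : 0 < (P.leadingCoeff * P.eval u) * (P.leadingCoeff * P.eval v) := by
      have e : (P.leadingCoeff * P.eval u) * (P.leadingCoeff * P.eval v) = P.leadingCoeff ^ 2 * (P.eval u * P.eval v) := by ring
      rw [e]
      exact mul_pos (lt_of_le_of_ne (sq_nonneg _) (Ne.symm (pow_ne_zero 2 hlc))) h
    exact ⟨fun h1 => (mul_pos_iff_of_pos_left h1).1 hprod, fun h1 => (mul_pos_iff_of_pos_right h1).1 hprod⟩
  rcases Nat.even_or_odd (P.roots.countP (fun x => v < x)) with hev | hodd
  · have heu : Even (P.roots.countP (fun x => u < x)) := hpu.2 (hiff.2 (hpv.1 hev))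
    rw [hsplit] at heu
    exact (Nat.even_add.1 heu).2 hev
  · have hou : Odd (P.roots.countP (fun x => u < x)) := by
      rcases Nat.even_or_odd (P.roots.countP (fun x => u < x)) with he | ho
      · exact absurd (hpv.2 (hiff.1 (hpu.1 he))) (Nat.not_even_iff_odd.2 hodd)
      · exact ho
    rw [hsplit] at hou
    exact Nat.not_odd_iff_even.1 fun hA => (Nat.not_even_iff_odd.2 hodd) ((Nat.odd_add.1 hou).1 hA)

/-- **PARITY RULE IN A CELL**: between two positive zeros `u < v` of `D_{k+1}` at which `D_k` has the same sign, the continuant `D_{k+2}`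
has an EVEN number of zeros counted with multiplicity (nonzero links).  [this file + the interval parity] -/
theorem even_countP_roots_add_two_between (hb : ∀ t, b t ≠ 0) (k : ℕ) {u v : ℝ} (hu : 0 < u) (huv : u ≤ v)
    (hru : (pathDet a d b f (k + 1)).eval u = 0) (hrv : (pathDet a d b f (k + 1)).eval v = 0)
    (hsame : 0 < (pathDet a d b f k).eval u * (pathDet a d b f k).eval v) :
    Even ((pathDet a d b f (k + 2)).roots.countP (fun x => u < x ∧ x ≤ v)) :=
  even_countP_roots_Ioc_of_mul_pos huv
    (eval_add_two_mul_pos_of_roots_succ a d b f hb k hu (lt_of_lt_of_le hu huv) hru hrv hsame)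

end StaticTridiagonalRealPotential

end Summit.ValiantsHypothesis.ValiantsHypothesis.Theorems.KPlusLogSqLaw
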